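import Mathlib
import HarnessLib
import Summits.CriticalPhenomena.Ising3DConformalLimit.Theses.EnergyNotSigmaSquared
import Literature.Probability.LatticeModels.IntersectionSourceSwitch
import Literature.Probability.LatticeModels.CurrentsPartialMonotonicity

/-!
# Crux `GapForcesFarMerging` (stmt-CriticalPhenomena-4468) — ideator 1, round 1:
# first lemmas of the card `reroot-avoidance-domination`

Finite-graph (un-normalised current-sum, `ℝ≥0∞`) forms, general couplings `K ≥ 0`, exactly in the
vocabulary of `IntersectionSourceSwitch.lean` / `CurrentsPartialMonotonicity.lean`
(`epairWeight K A B (n₁,n₂) = 1{∂n₁=A}1{∂n₂=B} w w`, `Z[A] = ecurrentSum K A`,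
`connInd u x p = 𝟙[u ∈ C_{p.1+p.2}(x)]`).

* `tsum_prod_connInd_connInd_eq_switch₂` — **FIRST LEMMA (exact two-site re-rooting, PROVED)**: for the
  duplicated pinched pair `P^{oy₁,∅} ⊗ P^{ay₂,∅}` and two sites `u₁, u₂`,
  `∑ W_{oy₁,∅}(p) W_{ay₂,∅}(q) 𝟙[u₁ ∈ C_p(o)] 𝟙[u₂ ∈ C_q(a)] Φ(p₁+p₂, q₁+q₂)`
  `= ∑ W_{y₁u₁, ou₁}(p) W_{y₂u₂, au₂}(q) Φ(p₁+p₂, q₁+q₂)`: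
  on the right the four currents are INDEPENDENT — `p.2, q.2` (sources `{o,u₁}`, `{a,u₂}`) are the
  inner pinched pair, `p.1, q.1` (sources `{y₁,u₁}`, `{y₂,u₂}`) the outer (fat when `|u₁-u₂| ≍ |u₁|`) pair.
  (The tree's `Current.tsum_prod_connInd_mul_connInd_mul_eq_switch` is the case `u₁ = u₂`.)
* `quadDisconnInd` — the avoidance functional `𝟙[a ∉ C_{p₁+p₂+q₁+q₂}(o)]` (total disconnection in the
  sum of the four currents; it is a function of `(p₁+p₂, q₁+q₂)`, so the first lemma applies to it).
* `quadDisconnInd_le_innerDisconnInd` — in the re-rooted system total avoidance implies avoidance of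
  the inner pair (PROVED, `cluster_mono`).
* `AvoidanceDominationOnePoint` — **the stub (AD-i) of the card**, as a `Prop`: re-rooting through
  one-point-typical sites of an annulus `U` does not make avoidance more likely, i.e.
  `E[X₁ X₂ ; avoid] ≤ C · E[X₁] E[X₂] · P[avoid]` with `X_i = |C_i ∩ U|` (cross-multiplied).
* `reroot_avoid_le_of_dom` — (AD-i) rewritten through the first lemma: the `U × U`-sum of re-rooted
  avoidance masses is at most `C ·` (one-point masses) `·` (original avoidance mass) (PROVED from the two
  items above; this is the inequality the card's recursion `ā(R/λ) ≤ C'' ā(R)` is built on).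
* `no_powerlaw_under_ratio_lower_bound` — the real-variable endgame of the card (a sequence with
  `a (k+1) ≥ c · a k`, `a 0 > 0` cannot satisfy `a k ≤ C θ^k` when `θ < c`), PROVED.
-/

noncomputable section

open Finset Filter
open scoped symmDiff ENNReal

namespace Summit.CriticalPhenomena.Ising3DConformalLimit.Cruxes.GapForcesFarMerging.Reroot

open Literature.Probability.LatticeModels Literature.Probability.LatticeModels.Current

variable {V : Type*} [Fintype V] [DecidableEq V] {G : SimpleGraph V} [DecidableRel G.Adj]
variable {K : G.edgeFinset → ℝ}

/-- **First lemma (exact two-site re-rooting of the duplicated pinched pair).** For `K ≥ 0`, vertices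
`o y₁ a y₂ u₁ u₂` and `Φ ≥ 0` a function of the two summed currents,
`∑_{p,q} 1{oy₁}1{∅}(p) 1{ay₂}1{∅}(q) w⁴ 𝟙[u₁ ∈ C_p(o)] 𝟙[u₂ ∈ C_q(a)] Φ(p₁+p₂, q₁+q₂)`
`= ∑_{p,q} 1{y₁u₁}1{ou₁}(p) 1{y₂u₂}1{au₂}(q) w⁴ Φ(p₁+p₂, q₁+q₂)`, i.e.
`P^{oy₁,∅,ay₂,∅}[u₁ ∈ C₁, u₂ ∈ C₂, E] = a_{o,y₁}(u₁) a_{a,y₂}(u₂) · P^{y₁u₁, ou₁, y₂u₂, au₂}[E]`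
with the exact one-point densities `a_{x,y}(u) = ⟨σ_xσ_u⟩⟨σ_uσ_y⟩/⟨σ_xσ_y⟩`
(Aizenman–Duminil-Copin 2021, §4.1, switching step, used there with `u₁ = u₂`). -/
theorem tsum_prod_connInd_connInd_eq_switch₂ (hK : ∀ e, 0 ≤ K e) (o y₁ a y₂ u₁ u₂ : V)
    (Φ : Current G → Current G → ℝ≥0∞) :
    ∑' pq : (Current G × Current G) × (Current G × Current G),
        epairWeight K ({o} ∆ {y₁}) ∅ pq.1 * epairWeight K ({a} ∆ {y₂}) ∅ pq.2 *
          (connInd u₁ o pq.1 * connInd u₂ a pq.2 * Φ (pq.1.1 + pq.1.2) (pq.2.1 + pq.2.2)) =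
      ∑' pq : (Current G × Current G) × (Current G × Current G),
        epairWeight K ({y₁} ∆ {u₁}) ({o} ∆ {u₁}) pq.1 * epairWeight K ({y₂} ∆ {u₂}) ({a} ∆ {u₂}) pq.2 *
          Φ (pq.1.1 + pq.1.2) (pq.2.1 + pq.2.2) := by
  conv_lhs => rw [ENNReal.tsum_prod']
  conv_rhs => rw [ENNReal.tsum_prod']
  show ∑' p, ∑' q, epairWeight K ({o} ∆ {y₁}) ∅ p * epairWeight K ({a} ∆ {y₂}) ∅ q *
      (connInd u₁ o p * connInd u₂ a q * Φ (p.1 + p.2) (q.1 + q.2)) =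
    ∑' p, ∑' q, epairWeight K ({y₁} ∆ {u₁}) ({o} ∆ {u₁}) p * epairWeight K ({y₂} ∆ {u₂}) ({a} ∆ {u₂}) q *
      Φ (p.1 + p.2) (q.1 + q.2)
  -- switch the second pair inside (for each `p`), then the first pair outside (for each `q`)
  have hinner : ∀ p : Current G × Current G,
      ∑' q : Current G × Current G, epairWeight K ({o} ∆ {y₁}) ∅ p * epairWeight K ({a} ∆ {y₂}) ∅ q *
          (connInd u₁ o p * connInd u₂ a q * Φ (p.1 + p.2) (q.1 + q.2)) =
        ∑' q : Current G × Current G, epairWeight K ({o} ∆ {y₁}) ∅ p * (connInd u₁ o p *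
          (epairWeight K ({y₂} ∆ {u₂}) ({a} ∆ {u₂}) q * Φ (p.1 + p.2) (q.1 + q.2))) := by
    intro p
    rw [ENNReal.tsum_mul_left, ENNReal.tsum_mul_left,
      ← tsum_epairWeight_mul_connInd_mul_eq_switch hK a y₂ u₂ (Φ (p.1 + p.2)), ← ENNReal.tsum_mul_left,
      ← ENNReal.tsum_mul_left]
    exact tsum_congr fun q => by ring
  have houter : ∀ q : Current G × Current G,
      ∑' p : Current G × Current G, epairWeight K ({o} ∆ {y₁}) ∅ p * (connInd u₁ o p *
          (epairWeight K ({y₂} ∆ {u₂}) ({a} ∆ {u₂}) q * Φ (p.1 + p.2) (q.1 + q.2))) =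
        ∑' p : Current G × Current G, epairWeight K ({y₁} ∆ {u₁}) ({o} ∆ {u₁}) p *
          (epairWeight K ({y₂} ∆ {u₂}) ({a} ∆ {u₂}) q * Φ (p.1 + p.2) (q.1 + q.2)) := fun q =>
    tsum_epairWeight_mul_connInd_mul_eq_switch hK o y₁ u₁
      (fun m => epairWeight K ({y₂} ∆ {u₂}) ({a} ∆ {u₂}) q * Φ m (q.1 + q.2))
  rw [tsum_congr hinner, ENNReal.tsum_comm, tsum_congr houter, ENNReal.tsum_comm]
  exact tsum_congr fun p => tsum_congr fun q => by ring

/-- The avoidance functional of the card: `𝟙[a ∉ C_{p₁+p₂+q₁+q₂}(o)]`, total disconnection of the two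
roots in the sum of all four currents. In the original system `(p,q) = ((n₁,n₁'),(n₂,n₂'))` this is the
duplicated avoidance `{o ↮ a in N₁+N₂}` (`N_i = n_i + n_i'`), which is implied by — hence at most as
likely as — the un-duplicated avoidance `{o ↮ a in n₁+n₂}` whose probability GAP bounds. [folklore] -/
def quadDisconnInd (o a : V) (pq : (Current G × Current G) × (Current G × Current G)) : ℝ≥0∞ :=
  if a ∈ (pq.1.1 + pq.1.2 + (pq.2.1 + pq.2.2)).cluster o then 0 else 1

/-- Avoidance of the INNER pair of the re-rooted system: `𝟙[a ∉ C_{p₂+q₂}(o)]` (`p.2`, `q.2` carry the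
sources `{o,u₁}`, `{a,u₂}` after re-rooting). [folklore] -/
def innerDisconnInd (o a : V) (pq : (Current G × Current G) × (Current G × Current G)) : ℝ≥0∞ :=
  if a ∈ (pq.1.2 + pq.2.2).cluster o then 0 else 1

/-- Total avoidance implies inner avoidance (the inner pair is a sub-current of the total). [folklore] -/
theorem quadDisconnInd_le_innerDisconnInd (o a : V) (pq : (Current G × Current G) × (Current G × Current G)) :
    quadDisconnInd o a pq ≤ innerDisconnInd o a pq := by
  unfold quadDisconnInd innerDisconnInd
  by_cases h : a ∈ (pq.1.2 + pq.2.2).cluster o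
  · have hle : pq.1.2 + pq.2.2 ≤ pq.1.1 + pq.1.2 + (pq.2.1 + pq.2.2) := by
      intro e
      simp only [Pi.add_apply]
      omega
    have h' : a ∈ (pq.1.1 + pq.1.2 + (pq.2.1 + pq.2.2)).cluster o := cluster_mono hle o h
    simp [h, h']
  · simp only [h, if_false]
    split_ifs <;> simp

/-- **(AD-i) — avoidance-domination, one-point form (the card's crux-level stub), cross-multiplied.**
For roots `o` (with far target `y₁`) and `a` (with far target `y₂`), an insertion set `U` (an annulus
`Ann(r,2r)` around the pinch, `r ≤ |y|/λ`, in the application) and a constant `C`: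
`(∑_{u₁,u₂ ∈ U} E^{oy₁,∅,ay₂,∅}[u₁ ∈ C₁, u₂ ∈ C₂ ; avoid]) ≤ C · E[|C₁ ∩ U|] E[|C₂ ∩ U|] · P[avoid]`,
`avoid = {o ↮ a in N₁+N₂}`, written with the three-point identity
`E[|C_i ∩ U|] · Z[x y]Z[∅] = ∑_{u ∈ U} Z[y u] Z[x u]`. Conditioning on the DECREASING event `avoid`
should not inflate the INCREASING functional `|C₁ ∩ U| |C₂ ∩ U|`: an FKG-shaped inequality for the
duplicated double current (random currents are not FKG; this specific one-sided instance is the bet). -/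
def AvoidanceDominationOnePoint (K : G.edgeFinset → ℝ) (C : ℝ≥0∞) (o y₁ a y₂ : V) (U : Finset V) : Prop :=
  (∑ u₁ ∈ U, ∑ u₂ ∈ U,
      ∑' pq : (Current G × Current G) × (Current G × Current G),
        epairWeight K ({o} ∆ {y₁}) ∅ pq.1 * epairWeight K ({a} ∆ {y₂}) ∅ pq.2 *
          (connInd u₁ o pq.1 * connInd u₂ a pq.2 * quadDisconnInd o a pq)) *
    (ecurrentSum K ({o} ∆ {y₁}) * ecurrentSum K ∅ * (ecurrentSum K ({a} ∆ {y₂}) * ecurrentSum K ∅)) ≤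
  C * ((∑ u₁ ∈ U, ecurrentSum K ({y₁} ∆ {u₁}) * ecurrentSum K ({o} ∆ {u₁})) *
        (∑ u₂ ∈ U, ecurrentSum K ({y₂} ∆ {u₂}) * ecurrentSum K ({a} ∆ {u₂}))) *
    ∑' pq : (Current G × Current G) × (Current G × Current G),
      epairWeight K ({o} ∆ {y₁}) ∅ pq.1 * epairWeight K ({a} ∆ {y₂}) ∅ pq.2 * quadDisconnInd o a pq

/-- **The re-rooting inequality the recursion is built on.** Under (AD-i), the `U × U`-sum of the
avoidance masses of the RE-ROOTED systems `P^{y₁u₁, ou₁, y₂u₂, au₂}` (independent inner pinched pair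
`⊗` outer pair) is at most `C ·` (product of one-point masses) `·` (original avoidance mass): divide by
`Z[oy₁]Z[∅]Z[ay₂]Z[∅]` to read `avg_{u ~ a⊗a} P^{rr(u)}[avoid] ≤ C · P^{orig}[avoid]`. Combined with
`quadDisconnInd_le_innerDisconnInd` and independence of inner/outer currents this is the step
`ā(r) · (order-one outer/bridging factor) ≤ C · ā(R)` of the card. -/
theorem reroot_avoid_le_of_dom (hK : ∀ e, 0 ≤ K e) {C : ℝ≥0∞} {o y₁ a y₂ : V} {U : Finset V}
    (hAD : AvoidanceDominationOnePoint K C o y₁ a y₂ U) :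
    (∑ u₁ ∈ U, ∑ u₂ ∈ U,
        ∑' pq : (Current G × Current G) × (Current G × Current G),
          epairWeight K ({y₁} ∆ {u₁}) ({o} ∆ {u₁}) pq.1 * epairWeight K ({y₂} ∆ {u₂}) ({a} ∆ {u₂}) pq.2 *
            quadDisconnInd o a pq) *
      (ecurrentSum K ({o} ∆ {y₁}) * ecurrentSum K ∅ * (ecurrentSum K ({a} ∆ {y₂}) * ecurrentSum K ∅)) ≤
    C * ((∑ u₁ ∈ U, ecurrentSum K ({y₁} ∆ {u₁}) * ecurrentSum K ({o} ∆ {u₁})) *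
          (∑ u₂ ∈ U, ecurrentSum K ({y₂} ∆ {u₂}) * ecurrentSum K ({a} ∆ {u₂}))) *
      ∑' pq : (Current G × Current G) × (Current G × Current G),
        epairWeight K ({o} ∆ {y₁}) ∅ pq.1 * epairWeight K ({a} ∆ {y₂}) ∅ pq.2 * quadDisconnInd o a pq := by
  have key : ∀ u₁ u₂ : V,
      ∑' pq : (Current G × Current G) × (Current G × Current G),
          epairWeight K ({y₁} ∆ {u₁}) ({o} ∆ {u₁}) pq.1 * epairWeight K ({y₂} ∆ {u₂}) ({a} ∆ {u₂}) pq.2 *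
            quadDisconnInd o a pq =
        ∑' pq : (Current G × Current G) × (Current G × Current G),
          epairWeight K ({o} ∆ {y₁}) ∅ pq.1 * epairWeight K ({a} ∆ {y₂}) ∅ pq.2 *
            (connInd u₁ o pq.1 * connInd u₂ a pq.2 * quadDisconnInd o a pq) := by
    intro u₁ u₂
    have h := tsum_prod_connInd_connInd_eq_switch₂ hK o y₁ a y₂ u₁ u₂
      (fun m m' => if a ∈ (m + m').cluster o then (0 : ℝ≥0∞) else 1)
    simpa only [quadDisconnInd] using h.symm
  simp_rw [key]
  exact hAD

/-- **Real-variable endgame of the card.** A positive sequence with the ratio lower bound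
`a (k+1) ≥ c · a k` (the recursion `ā(R_{k}) ≥ c ā(R_{k-1})` along scales `R_k = λ^k R₀`, obtained under
`¬FarMerging` from the re-rooting inequality, avoidance-domination and the bridging bound) cannot decay
like `C θ^k` with `θ < c` (the RP/GAP bound `ā(R) ≤ C R^{-κ/2}` gives `θ = λ^{-κ/2}`, and `c` does not
depend on `λ`, so `λ` large is contradictory). [folklore] -/
theorem no_powerlaw_under_ratio_lower_bound {a : ℕ → ℝ} {c θ C : ℝ} (hc : 0 < c) (hθ : 0 < θ)
    (hθc : θ < c) (h0 : 0 < a 0) (hrec : ∀ k, c * a k ≤ a (k + 1)) (hdec : ∀ k, a k ≤ C * θ ^ k) : False := by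
  -- `a k ≥ c^k a 0`, hence `(c/θ)^k ≤ C / a 0` for all `k`, impossible since `c/θ > 1`.
  have hlow : ∀ k, c ^ k * a 0 ≤ a k := by
    intro k
    induction k with
    | zero => simp
    | succ k ih =>
      calc c ^ (k + 1) * a 0 = c * (c ^ k * a 0) := by ring
        _ ≤ c * a k := by exact mul_le_mul_of_nonneg_left ih hc.le
        _ ≤ a (k + 1) := hrec k
  have hratio : ∀ k, (c / θ) ^ k ≤ C / a 0 := by
    intro k
    have h1 : c ^ k * a 0 ≤ C * θ ^ k := (hlow k).trans (hdec k)
    have hθk : 0 < θ ^ k := pow_pos hθ k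
    rw [div_pow, div_le_div_iff₀ hθk h0]
    linarith
  have hgt : 1 < c / θ := by rw [lt_div_iff₀ hθ]; linarith
  obtain ⟨k, hk⟩ := pow_unbounded_of_one_lt (C / a 0) hgt
  exact absurd (hratio k) (not_le.mpr hk)

end Summit.CriticalPhenomena.Ising3DConformalLimit.Cruxes.GapForcesFarMerging.Reroot
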